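import Literature.MathematicalPhysics.QuantumFieldTheory.DimockYuan2024.QuadraticFlow
import Literature.Analysis.SpecialFunctions.GammaVerticalRatio
import Mathlib.Analysis.SpecialFunctions.Pow.Deriv
import Mathlib.Analysis.Calculus.Deriv.MeanValue
import Mathlib.Analysis.Complex.ExponentialBounds

/-!
# Dimock–Yuan: sums and products along the quadratic flow — (basicbound) second line and Lemma 19,
PROVED with explicit constants and explicit smallness

**Citation header (reproduction of PUBLISHED work; template file of the Balaban lattice Yang–Mills
cell `pub-balaban`, TEMPLATE.md §16; no manuscript under audit is touched).**
J. Dimock, C. Yuan, *Structural stability of the RG flow in the Gross–Neveu model*,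
Ann. Henri Poincaré **25** (2024) (= arXiv:2303.07916v3; doi 10.1007/s00023-024-01427-0)
[DimockYuan2024GNFlow], §4.1 remark after Lemma 17, eq. (basicbound)/(basicbound2) (arXiv TeX
ll. 3386–3402, p. 57), and §4.3 **Lemma 19** (TeX label `gamma`, ll. 3705–3725, p. 62).  TeX line numbers refer to the
cell's held source `inputs/files/dimock/src/2303.07916/2303.07916.tex`
(§ numbering: arXiv v3, whose section *"The flow"* is §4 — TeX l. 3274, `\label{five}` being a NAME —,
subsections §4.1–4.5; this file's earlier versions and TEMPLATE.md ≤ v8.31 wrote «§5.x»; corrected after XREAD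
C-pv02g21-1 (D3); printed pages are those of the arXiv-v3 PDF.).  The remark cites
R. Bauerschmidt, D. C. Brydges, G. Slade, *Structural stability of a dynamical system near a
non-hyperbolic fixed point*, Ann. Henri Poincaré **16** (2015) 1033–1065 (= arXiv:1211.2477)
[BauerschmidtBrydgesSlade2015Flow], Lemma 2.1 (ii-a), eq. (betagbd) — the same estimate for the
infrared-directed recursion `ḡ_{j+1} = ḡ_j − β_j ḡ_j²`, proved there by comparison with
`∫ ψ(t) dt`, `ψ(t) = t^{n−2}|log t|^m` (arXiv v3 §2.1, materialised pp. 8–9 of the cell's text copy).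

**What the sources print.**  (basicbound), second line (D10 ll. 3390–3395): *"One can deduce directly
from the equation `ḡ_{k+1} = ḡ_k + β_k ḡ_k²` that for `0 ≤ j ≤ k ≤ N` …
`Σ_{ℓ=j}^k β_ℓ ḡ_ℓ^n |log ḡ_ℓ|^m ≤ 𝒪(1) ḡ_{k+1}^{n−1} |log ḡ_{k+1}|^m`, `n > 1, m ≥ 0`"* — stated WITHOUT
proof (*"We will use the following estimates similar to those of Lemma 2.1 in [BBS15c]"*, l. 3388), and
(basicbound2) (ll. 3396–3402): *"Or since `C₋ ≤ β_ℓ ≤ C₊` we have for `C = 𝒪(1)C₋⁻¹`: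
`Σ_{ℓ=j}^k ḡ_ℓ ≤ C|log ḡ_j|`, `Σ_{ℓ=j}^k ḡ_ℓ^n|log ḡ_ℓ|^m ≤ C ḡ_{k+1}^{n−1}|log ḡ_{k+1}|^m`, `n > 1, m ≥ 0`"*.
Lemma 19 (ll. 3705–3711): *"For `g_f` sufficiently small and `γ > 0`:
`½(ḡ_k/ḡ_ℓ)^γ ≤ Π_{i=ℓ}^{k−1}(1 + γβ_iḡ_i) ≤ (3/2)(ḡ_k/ḡ_ℓ)^γ`"*, with the six-line sketch
*"Define `α_i` by `(1 + γβ_iḡ_i) = (1 + β_iḡ_i)^γ(1 + α_i)`. Then `α_i = 𝒪(ḡ_i²)` and since `Σ_i ḡ_i²` is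
small we have `½ ≤ Π(1 + α_i) ≤ 3/2`. On the other hand from `(1 + β_iḡ_i) = ḡ_{i+1}/ḡ_i`:
`Π(1 + β_iḡ_i)^γ = (ḡ_k/ḡ_ℓ)^γ`"* (ll. 3714–3725).  USES in D10 §4.3 (proof of Lemma 18): (amos3)
l. 3628–3631 with the REAL exponent `n = 3 − √2 ∈ (1,2)`, `m = 0`; the `z_k`-equation ll. 3692–3696 with
`n = 3`, `m = 1`; and Lemma 19 with `γ = √2` (l. 3624) and, inverted, `γ = 2` (ll. 3654–3656, the factors
`A_k = (1 + 2β_kḡ_k)⁻¹`).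

**What is PROVED here (Mathlib + the sibling `QuadraticFlow` only; no named facts, no `def`).**
Throughout `ḡ = gbar β N g_f` is the backward quadratic flow of `QuadraticFlow` (`ḡ_N = g_f`,
`ḡ_{k+1} = ḡ_k + β_kḡ_k²`, `0 < C₋ ≤ β_k ≤ C₊`, `C₊g_f ≤ 1`), sums over `ℓ ∈ [j, n)` with `j ≤ n ≤ N`
(the print's `Σ_{ℓ=j}^{k}` with endpoint `ḡ_{k+1}` is the case `n = k + 1`), and the exponent the print
calls `n` is called `p` (real, `p > 1`); `m` is real, `m ≥ 0`, as printed.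
* Part 1 — the POTENTIAL `φ(g) = g^{p−1}(−log g)^m` on `(0,1)`: `hasDerivAt_potential`
  (`φ'(g) = (p−1)g^{p−2}(−log g)^m − m g^{p−2}(−log g)^{m−1}`), `potential_deriv_lower`
  (`φ'(g) ≥ ((p−1)/2)·g^{p−2}(−log g)^m` once `(p−1)(−log g) ≥ 2m`), `potential_deriv_lower_on`
  (for `x ≤ ξ ≤ 2x`, `x ≤ 1/4`: `φ'(ξ) ≥ (p−1)2^{−(m+2)}·x^{p−2}(−log x)^m`), and `potential_increment`
  (the mean-value step `(p−1)2^{−(m+2)}x^{p−2}(−log x)^m·(y−x) ≤ φ(y) − φ(x)` for `x ≤ y ≤ 2x`, via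
  Mathlib's `Convex.mul_sub_le_image_sub_of_le_deriv`).  This is the discrete antiderivative behind
  BBS's integral comparison (betagbd), run in the ultraviolet direction.
* Part 2 — **(basicbound), second line, PROVED with `𝒪(1) = 2^{m+2}/(p−1)`**: per step
  `step_bound` (`β_ℓḡ_ℓ^p(−log ḡ_ℓ)^m ≤ (2^{m+2}/(p−1))(φ(ḡ_{ℓ+1}) − φ(ḡ_ℓ))`), telescoped
  `sum_le_potential_sub`, and the printed shapes **`basicbound_two`** / `basicbound_two_abs`
  (`Σ_{ℓ∈[j,n)} β_ℓḡ_ℓ^p|log ḡ_ℓ|^m ≤ (2^{m+2}/(p−1))·ḡ_n^{p−1}|log ḡ_n|^m`), under the explicit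
  smallness `g_f ≤ 1/4` and `g_f ≤ exp(−2m/(p−1))` (both are *"g_f sufficiently small"*, the second
  depending on `(p, m)` — for `m = 0` it is void, for `(p, m) = (3, 1)` it reads `g_f ≤ e^{−1}` and is
  implied by `g_f ≤ 1/4`); **(basicbound2)** both lines: `basicbound2_one` (`C = 2/C₋`, from the
  sibling's `sum_beta_gbar_le_abs_log`) and `basicbound2_two` (`C = 2^{m+2}/((p−1)C₋)`).
* Part 3 — **Lemma 19 PROVED** with the smallness made explicit and γ-dependent: the per-factor
  inequalities `one_add_mul_le_rpow_mul_exp` (`1 + γt ≤ (1+t)^γ e^{γt²}`) and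
  `rpow_mul_exp_neg_le_one_add_mul` (`(1+t)^γ e^{−γ²t²} ≤ 1 + γt`) for `t, γ ≥ 0` (from
  `u − u² ≤ 1 − (1+u)⁻¹ ≤ log(1+u) ≤ u`; the first of these is the tree's
  `Literature.Analysis.SpecialFunctions.GammaRatio.sub_sq_le_log_one_add`, reused by name), the telescoping product `prod_one_add_beta_gbar`
  (`Π_{i∈[ℓ,k)}(1 + β_iḡ_i) = ḡ_k/ḡ_ℓ`), the two-sided bound with exponential corrections
  `prod_bounds_exp` (`(ḡ_k/ḡ_ℓ)^γ e^{−γ²C₊(ḡ_k−ḡ_ℓ)} ≤ Π(1+γβ_iḡ_i) ≤ (ḡ_k/ḡ_ℓ)^γ e^{γC₊(ḡ_k−ḡ_ℓ)}` —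
  the print's `Π(1+α_i)` located exactly), and **`DimockYuan2024_lemma19`**: the printed
  `½(ḡ_k/ḡ_ℓ)^γ ≤ Π ≤ (3/2)(ḡ_k/ḡ_ℓ)^γ` under `γ·C₊g_f ≤ log(3/2)` and `γ²·C₊g_f ≤ log 2`; plus the
  inverted form `prod_inv_le` (`Π(1+γβ_iḡ_i)⁻¹ ≤ 2(ḡ_ℓ/ḡ_k)^γ`, the shape used at l. 3656).
* Part 4 — the two USED instances, as corollaries: `amos3_sum`
  (`ḡ_k^{√2}·Σ_{ℓ<k} ḡ_ℓ^{3−√2} ≤ (4/((2−√2)C₋))·ḡ_k²`, l. 3629) and `zsum_bound`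
  (`Σ_{ℓ<k} ḡ_ℓ³|log ḡ_ℓ| ≤ (4/C₋)·ḡ_k²|log ḡ_k|`, l. 3694), both under `g_f ≤ 1/4`, `C₊g_f ≤ 1` only.

**Located precision (Dimock-internal, records only; D10 is template, not under audit).**  In Lemma 19
*"g_f sufficiently small"* must depend on `γ` (the kernel's `γC₊g_f ≤ log(3/2)`, `γ²C₊g_f ≤ log 2`);
in the paper `γ ∈ {√2, 2}` is fixed, so nothing is affected.  In (basicbound) the `𝒪(1)` depends on
`(n, m)` (kernel: `2^{m+2}/(n−1)`, blowing up as `n ↓ 1`, consistent with the separate first line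
for `n = 1`), as BBS's `C_{n,m}` does explicitly.

**Why it is in the tree / scope.**  TEMPLATE.md §16.2/§16.5: the elementary flow toolkit of the
printed-and-proved marginal-coupling analog (Gross–Neveu, `d = 2`) of Bałaban's CMP 109 Theorem 2
(lattice YM₄; proof not in print — cell files MISSING.md §A1, GAPS G1).  With the sibling
`QuadraticFlow` (Lemma 17, (basicbound) first line) every by-assertion arithmetic step of D10 §4.1 and
the product lemma of §4.3 are now kernel; what remains of D10 §4 un-formalised is the functional
analysis (Lemmas 18, 20–22, Theorem 4: the solution operators on the weighted sequence spaces and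
the contraction).  SCOPE: Dimock–Yuan's RG is a momentum-slice decomposition on the continuum torus,
not Bałaban's block averaging; only these flow estimates are model-independent.  Nothing here refers
to or asserts anything about Bałaban's papers.  Value = kernel reproduction of two printed-without-proof
/ sketched estimates of the template literature with constants, NOT summit progress.

Cell records: unit `b2b-balaban-template` gen 24; GAPS.md C-tmpl24-1.  NEW leaf; imports the sibling
`…DimockYuan2024.QuadraticFlow`, the tree's `Literature.Analysis.SpecialFunctions.GammaVerticalRatio` (for
the one elementary `log` inequality, gate dedup) and three Mathlib files; sub-namespace
`…DimockYuan2024.QuadraticFlowSums`; modifies nothing.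
-/

noncomputable section

open Finset Real Set

namespace Literature.MathematicalPhysics.QuantumFieldTheory.DimockYuan2024.QuadraticFlowSums

/-! ## Part 1. The potential `φ(g) = g^{p−1}(−log g)^m` on `(0,1)` -/

/-- Derivative of the potential `φ(g) = g^{p−1}(−log g)^m` at `0 < g < 1` (real `p`, `m`):
`φ'(g) = (p−1) g^{p−2} (−log g)^m − m g^{p−2} (−log g)^{m−1}`. [folklore] (elementary calculus; the
discrete antiderivative replacing the integral comparison of
[cite: BauerschmidtBrydgesSlade2015Flow, Lemma 2.1 (ii-a), eq. (gbarsumbis)/(betagbd)]) -/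
theorem hasDerivAt_potential (p m : ℝ) {g : ℝ} (hg0 : 0 < g) (hg1 : g < 1) :
    HasDerivAt (fun x : ℝ => x ^ (p - 1) * (-Real.log x) ^ m)
      ((p - 1) * g ^ (p - 2) * (-Real.log g) ^ m
        - m * g ^ (p - 2) * (-Real.log g) ^ (m - 1)) g := by
  have hL : 0 < -Real.log g := by
    have := Real.log_neg hg0 hg1
    linarith
  have h1 : HasDerivAt (fun x : ℝ => x ^ (p - 1)) ((p - 1) * g ^ (p - 1 - 1)) g :=
    Real.hasDerivAt_rpow_const (Or.inl hg0.ne')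
  have h2 : HasDerivAt (fun x : ℝ => -Real.log x) (-(g⁻¹)) g :=
    (Real.hasDerivAt_log hg0.ne').neg
  have h3 : HasDerivAt (fun x : ℝ => (-Real.log x) ^ m)
      (-(g⁻¹) * m * (-Real.log g) ^ (m - 1)) g :=
    h2.rpow_const (Or.inl hL.ne')
  have h4 : HasDerivAt (fun x : ℝ => x ^ (p - 1) * (-Real.log x) ^ m)
      ((p - 1) * g ^ (p - 1 - 1) * (-Real.log g) ^ m
        + g ^ (p - 1) * (-(g⁻¹) * m * (-Real.log g) ^ (m - 1))) g := h1.mul h3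
  have e1 : p - 1 - 1 = p - 2 := by ring
  have e2 : g ^ (p - 1) * g⁻¹ = g ^ (p - 2) := by
    rw [← Real.rpow_neg_one g, ← Real.rpow_add hg0]
    congr 1
  refine h4.congr_deriv ?_
  have e3 : g ^ (p - 1) * (-(g⁻¹) * m * (-Real.log g) ^ (m - 1))
      = -(m * (g ^ (p - 1) * g⁻¹) * (-Real.log g) ^ (m - 1)) := by ring
  rw [e1, e3, e2]
  ring

/-- Lower bound of `φ'` where the logarithm dominates: if `(p−1)(−log g) ≥ 2m` then
`φ'(g) ≥ ((p−1)/2)·g^{p−2}(−log g)^m`. [folklore] -/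
theorem potential_deriv_lower {p m g : ℝ} (hg0 : 0 < g) (hg1 : g < 1)
    (hlog : 2 * m ≤ (p - 1) * (-Real.log g)) :
    (p - 1) / 2 * (g ^ (p - 2) * (-Real.log g) ^ m) ≤
      (p - 1) * g ^ (p - 2) * (-Real.log g) ^ m
        - m * g ^ (p - 2) * (-Real.log g) ^ (m - 1) := by
  set L := -Real.log g with hLdef
  have hL : 0 < L := by
    have := Real.log_neg hg0 hg1
    rw [hLdef]; linarith
  set A := g ^ (p - 2) with hAdef
  have hA : 0 ≤ A := Real.rpow_nonneg hg0.le _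
  have hLm : 0 ≤ L ^ m := Real.rpow_nonneg hL.le _
  have hLm1 : L ^ (m - 1) = L ^ m / L := Real.rpow_sub_one hL.ne' m
  rw [hLm1]
  have hkey : m * (L ^ m / L) ≤ (p - 1) / 2 * L ^ m := by
    rw [mul_div_assoc', div_le_iff₀ hL]
    have := mul_le_mul_of_nonneg_left hlog hLm
    nlinarith [this]
  have h5 := mul_le_mul_of_nonneg_left hkey hA
  calc (p - 1) / 2 * (A * L ^ m)
      = (p - 1) * A * L ^ m - A * ((p - 1) / 2 * L ^ m) := by ring
    _ ≤ (p - 1) * A * L ^ m - A * (m * (L ^ m / L)) := by linarith [h5]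
    _ = (p - 1) * A * L ^ m - m * A * (L ^ m / L) := by ring

/-- `x ≤ 1/4 ⟹ 2 log 2 ≤ −log x`. [folklore] -/
theorem two_mul_log_two_le_neg_log {x : ℝ} (hx0 : 0 < x) (hx4 : x ≤ 1 / 4) :
    2 * Real.log 2 ≤ -Real.log x := by
  have h4 : (4 : ℝ) ≤ x⁻¹ := by
    rw [inv_eq_one_div, le_div_iff₀ hx0]
    linarith
  have hlog4 : Real.log 4 = 2 * Real.log 2 := by
    rw [show (4 : ℝ) = 2 ^ 2 by norm_num, Real.log_pow]
    norm_num
  have := Real.log_le_log (by norm_num) h4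
  rw [Real.log_inv, hlog4] at this
  exact this

/-- Uniform lower bound of `φ'` on a doubling interval: for `0 < x ≤ 1/4`, `x ≤ ξ ≤ 2x`, `ξ < 1` and
`(p−1)(−log ξ) ≥ 2m` (with `p > 1`, `m ≥ 0`):
`φ'(ξ) ≥ (p−1)/2^{m+2} · x^{p−2}(−log x)^m`. [folklore] -/
theorem potential_deriv_lower_on {p m x ξ : ℝ} (hp : 1 < p) (hm : 0 ≤ m) (hx0 : 0 < x)
    (hx4 : x ≤ 1 / 4) (hξ1 : x ≤ ξ) (hξ2 : ξ ≤ 2 * x) (hξlt : ξ < 1)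
    (hlog : 2 * m ≤ (p - 1) * (-Real.log ξ)) :
    (p - 1) / (2 : ℝ) ^ (m + 2) * (x ^ (p - 2) * (-Real.log x) ^ m) ≤
      (p - 1) * ξ ^ (p - 2) * (-Real.log ξ) ^ m
        - m * ξ ^ (p - 2) * (-Real.log ξ) ^ (m - 1) := by
  have hξ0 : 0 < ξ := lt_of_lt_of_le hx0 hξ1
  have hLx : 2 * Real.log 2 ≤ -Real.log x := two_mul_log_two_le_neg_log hx0 hx4
  have hlog2 : 0 < Real.log 2 := Real.log_pos (by norm_num)
  have hLx0 : 0 ≤ -Real.log x := by linarith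
  -- (i) ξ^{p-2} ≥ ½ x^{p-2}
  have hpow : 1 / 2 * x ^ (p - 2) ≤ ξ ^ (p - 2) := by
    have hxp : 0 ≤ x ^ (p - 2) := Real.rpow_nonneg hx0.le _
    rcases le_or_gt 2 p with hp2 | hp2
    · have h := Real.rpow_le_rpow hx0.le hξ1 (by linarith : 0 ≤ p - 2)
      linarith
    · have h := Real.rpow_le_rpow_of_nonpos hξ0 hξ2 (by linarith : p - 2 ≤ 0)
      rw [Real.mul_rpow (by norm_num) hx0.le] at h
      have h2 : (1 / 2 : ℝ) ≤ (2 : ℝ) ^ (p - 2) := by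
        have := Real.rpow_le_rpow_of_exponent_le (by norm_num : (1 : ℝ) ≤ 2)
          (by linarith : (-1 : ℝ) ≤ p - 2)
        rw [Real.rpow_neg_one] at this
        linarith
      calc 1 / 2 * x ^ (p - 2) ≤ (2 : ℝ) ^ (p - 2) * x ^ (p - 2) :=
            mul_le_mul_of_nonneg_right h2 hxp
        _ ≤ ξ ^ (p - 2) := h
  -- (ii) (-log ξ)^m ≥ (-log x)^m / 2^m
  have hlogξ : -Real.log x / 2 ≤ -Real.log ξ := by
    have h := Real.log_le_log hξ0 hξ2
    rw [Real.log_mul (by norm_num) hx0.ne'] at h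
    linarith
  have hlogpow : (-Real.log x) ^ m / (2 : ℝ) ^ m ≤ (-Real.log ξ) ^ m := by
    have h := Real.rpow_le_rpow (by positivity : 0 ≤ -Real.log x / 2) hlogξ hm
    rwa [Real.div_rpow hLx0 (by norm_num) m] at h
  -- (iii) combine with the pointwise lower bound at ξ
  have hder := potential_deriv_lower (p := p) (m := m) hξ0 hξlt hlog
  have hprod : x ^ (p - 2) * (-Real.log x) ^ m / (2 : ℝ) ^ (m + 1) ≤
      ξ ^ (p - 2) * (-Real.log ξ) ^ m := by
    have h := mul_le_mul hpow hlogpow (by positivity) (Real.rpow_nonneg hξ0.le _)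
    have e : 1 / 2 * x ^ (p - 2) * ((-Real.log x) ^ m / (2 : ℝ) ^ m)
        = x ^ (p - 2) * (-Real.log x) ^ m / (2 : ℝ) ^ (m + 1) := by
      rw [Real.rpow_add (by norm_num : (0 : ℝ) < 2), Real.rpow_one]
      ring
    rw [e] at h
    exact h
  have hp1 : 0 ≤ (p - 1) / 2 := by linarith
  have h6 := mul_le_mul_of_nonneg_left hprod hp1
  have e2 : (p - 1) / 2 * (x ^ (p - 2) * (-Real.log x) ^ m / (2 : ℝ) ^ (m + 1))
      = (p - 1) / (2 : ℝ) ^ (m + 2) * (x ^ (p - 2) * (-Real.log x) ^ m) := by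
    have e3 : (2 : ℝ) ^ (m + 2) = (2 : ℝ) ^ (m + 1) * 2 := by
      rw [show m + 2 = (m + 1) + 1 by ring, Real.rpow_add (by norm_num : (0 : ℝ) < 2),
        Real.rpow_one]
    rw [e3]
    field_simp
  rw [e2] at h6
  exact h6.trans hder

/-- The mean-value step of the potential on a doubling interval: for `0 < x ≤ y ≤ 2x`, `x ≤ 1/4`,
`y < 1` and `(p−1)(−log y) ≥ 2m`:
`(p−1)/2^{m+2} · x^{p−2}(−log x)^m · (y − x) ≤ φ(y) − φ(x)`. [folklore] (Mathlib
`Convex.mul_sub_le_image_sub_of_le_deriv` on `[x, y]`) -/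
theorem potential_increment {p m x y : ℝ} (hp : 1 < p) (hm : 0 ≤ m) (hx0 : 0 < x)
    (hx4 : x ≤ 1 / 4) (hxy : x ≤ y) (hy2 : y ≤ 2 * x) (hy1 : y < 1)
    (hlog : 2 * m ≤ (p - 1) * (-Real.log y)) :
    (p - 1) / (2 : ℝ) ^ (m + 2) * (x ^ (p - 2) * (-Real.log x) ^ m) * (y - x) ≤
      y ^ (p - 1) * (-Real.log y) ^ m - x ^ (p - 1) * (-Real.log x) ^ m := by
  have hy0 : 0 < y := lt_of_lt_of_le hx0 hxy
  -- every point of [x, y] lies in (0, 1)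
  have hin : ∀ ξ ∈ Icc x y, 0 < ξ ∧ ξ < 1 := fun ξ hξ =>
    ⟨lt_of_lt_of_le hx0 hξ.1, lt_of_le_of_lt hξ.2 hy1⟩
  have hcont : ContinuousOn (fun t : ℝ => t ^ (p - 1) * (-Real.log t) ^ m) (Icc x y) :=
    fun ξ hξ => (hasDerivAt_potential p m (hin ξ hξ).1 (hin ξ hξ).2).continuousAt.continuousWithinAt
  have hdiff : DifferentiableOn ℝ (fun t : ℝ => t ^ (p - 1) * (-Real.log t) ^ m)
      (interior (Icc x y)) := by
    rw [interior_Icc]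
    intro ξ hξ
    exact (hasDerivAt_potential p m (lt_of_lt_of_le hx0 hξ.1.le)
      (lt_trans hξ.2 hy1)).differentiableAt.differentiableWithinAt
  have hge : ∀ ξ ∈ interior (Icc x y),
      (p - 1) / (2 : ℝ) ^ (m + 2) * (x ^ (p - 2) * (-Real.log x) ^ m) ≤
        deriv (fun t : ℝ => t ^ (p - 1) * (-Real.log t) ^ m) ξ := by
    rw [interior_Icc]
    intro ξ hξ
    have hξ0 : 0 < ξ := lt_of_lt_of_le hx0 hξ.1.le
    have hξ1 : ξ < 1 := lt_trans hξ.2 hy1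
    rw [(hasDerivAt_potential p m hξ0 hξ1).deriv]
    have hlogξ : 2 * m ≤ (p - 1) * (-Real.log ξ) := by
      have h := Real.log_le_log hξ0 hξ.2.le
      have hp0 : 0 ≤ p - 1 := by linarith
      have := mul_le_mul_of_nonneg_left (by linarith : -Real.log y ≤ -Real.log ξ) hp0
      linarith
    exact potential_deriv_lower_on hp hm hx0 hx4 hξ.1.le (by linarith [hξ.2]) hξ1 hlogξ
  exact (convex_Icc x y).mul_sub_le_image_sub_of_le_deriv hcont hdiff hge x
    (left_mem_Icc.mpr hxy) y (right_mem_Icc.mpr hxy) hxy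

/-! ## Part 2. (basicbound), second line -/

variable {β : ℕ → ℝ} {N : ℕ} {gf : ℝ}

/-- Per-step bound along the flow: with `x = ḡ_ℓ`, `y = ḡ_{ℓ+1} = x + β_ℓx² ≤ 2x`,
`β_ℓ ḡ_ℓ^p (−log ḡ_ℓ)^m ≤ (2^{m+2}/(p−1))·(φ(ḡ_{ℓ+1}) − φ(ḡ_ℓ))`, under `C₋ ≤ β ≤ C₊`, `C₊g_f ≤ 1`,
`g_f ≤ 1/4`, `g_f ≤ exp(−2m/(p−1))`.
[cite: DimockYuan2024GNFlow, remark after Lemma 17, (basicbound) second line (arXiv:2303.07916v3 TeX ll. 3390–3395; printed without proof)] -/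
theorem step_bound {Cm Cp p m : ℝ} (hCm : 0 < Cm) (hβ : ∀ k, Cm ≤ β k ∧ β k ≤ Cp)
    (hgf : 0 < gf) (hsmall : Cp * gf ≤ 1) (hgf4 : gf ≤ 1 / 4) (hp : 1 < p) (hm : 0 ≤ m)
    (hgfm : gf ≤ Real.exp (-(2 * m / (p - 1)))) {ℓ : ℕ} (hℓ : ℓ < N) :
    β ℓ * gbar β N gf ℓ ^ p * (-Real.log (gbar β N gf ℓ)) ^ m ≤
      (2 : ℝ) ^ (m + 2) / (p - 1) *
        (gbar β N gf (ℓ + 1) ^ (p - 1) * (-Real.log (gbar β N gf (ℓ + 1))) ^ m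
          - gbar β N gf ℓ ^ (p - 1) * (-Real.log (gbar β N gf ℓ)) ^ m) := by
  have hβpos : ∀ k, 0 < β k := fun k => lt_of_lt_of_le hCm (hβ k).1
  have hCp : 0 ≤ Cp := le_trans hCm.le ((hβ 0).1.trans (hβ 0).2)
  set x := gbar β N gf ℓ with hxdef
  set y := gbar β N gf (ℓ + 1) with hydef
  have hx0 : 0 < x := gbar_pos hβpos hgf (N := N) ℓ
  have hxle : x ≤ gf := gbar_le_final hβpos hgf (N := N) ℓ
  have hyle : y ≤ gf := gbar_le_final hβpos hgf (N := N) (ℓ + 1)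
  have hy0 : 0 < y := gbar_pos hβpos hgf (N := N) (ℓ + 1)
  have hsucc : y = x + β ℓ * x ^ 2 := gbar_succ hβpos hgf hℓ
  have ht1 : β ℓ * x ≤ 1 :=
    (mul_le_mul (hβ ℓ).2 hxle hx0.le hCp).trans hsmall
  have hxy : x ≤ y := by
    rw [hsucc]; nlinarith [mul_pos (hβpos ℓ) (pow_pos hx0 2)]
  have hy2 : y ≤ 2 * x := by
    rw [hsucc]
    have : β ℓ * x ^ 2 = (β ℓ * x) * x := by ring
    rw [this]
    nlinarith [mul_le_mul_of_nonneg_right ht1 hx0.le]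
  have hx4 : x ≤ 1 / 4 := hxle.trans hgf4
  have hy1 : y < 1 := by linarith [hyle.trans hgf4]
  -- the logarithmic condition at y from g_f ≤ exp(-2m/(p-1))
  have hlog : 2 * m ≤ (p - 1) * (-Real.log y) := by
    have h1 : Real.log y ≤ -(2 * m / (p - 1)) := by
      have h := Real.log_le_log hy0 (hyle.trans hgfm)
      rwa [Real.log_exp] at h
    have hp0 : 0 < p - 1 := by linarith
    have h2 : 2 * m / (p - 1) ≤ -Real.log y := by linarith
    rw [div_le_iff₀ hp0] at h2
    linarith
  have hinc := potential_increment hp hm hx0 hx4 hxy hy2 hy1 hlog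
  -- y - x = β x², and x^{p-2} x² = x^p
  have hyx : y - x = β ℓ * x ^ 2 := by rw [hsucc]; ring
  have hxp : x ^ (p - 2) * x ^ 2 = x ^ p := by
    rw [← Real.rpow_two, ← Real.rpow_add hx0]
    congr 1; ring
  have hK : 0 < (2 : ℝ) ^ (m + 2) / (p - 1) := by
    have : 0 < (2 : ℝ) ^ (m + 2) := Real.rpow_pos_of_pos (by norm_num) _
    exact div_pos this (by linarith)
  have e : β ℓ * x ^ p * (-Real.log x) ^ m
      = (2 : ℝ) ^ (m + 2) / (p - 1) *
          ((p - 1) / (2 : ℝ) ^ (m + 2) * (x ^ (p - 2) * (-Real.log x) ^ m) * (y - x)) := by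
    rw [hyx, ← hxp]
    have h2 : (2 : ℝ) ^ (m + 2) ≠ 0 := (Real.rpow_pos_of_pos (by norm_num) _).ne'
    have hp0 : p - 1 ≠ 0 := by linarith
    field_simp
  rw [e]
  exact mul_le_mul_of_nonneg_left hinc hK.le

/-- Telescoped: for `j ≤ n ≤ N`,
`Σ_{ℓ∈[j,n)} β_ℓ ḡ_ℓ^p (−log ḡ_ℓ)^m ≤ (2^{m+2}/(p−1))·(φ(ḡ_n) − φ(ḡ_j))`, `φ(g) = g^{p−1}(−log g)^m`.
[cite: DimockYuan2024GNFlow, remark after Lemma 17, (basicbound) second line (arXiv:2303.07916v3 TeX ll. 3390–3395; printed without proof)] -/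
theorem sum_le_potential_sub {Cm Cp p m : ℝ} (hCm : 0 < Cm) (hβ : ∀ k, Cm ≤ β k ∧ β k ≤ Cp)
    (hgf : 0 < gf) (hsmall : Cp * gf ≤ 1) (hgf4 : gf ≤ 1 / 4) (hp : 1 < p) (hm : 0 ≤ m)
    (hgfm : gf ≤ Real.exp (-(2 * m / (p - 1)))) {j n : ℕ} (hjn : j ≤ n) (hn : n ≤ N) :
    ∑ ℓ ∈ Ico j n, β ℓ * gbar β N gf ℓ ^ p * (-Real.log (gbar β N gf ℓ)) ^ m ≤
      (2 : ℝ) ^ (m + 2) / (p - 1) *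
        (gbar β N gf n ^ (p - 1) * (-Real.log (gbar β N gf n)) ^ m
          - gbar β N gf j ^ (p - 1) * (-Real.log (gbar β N gf j)) ^ m) := by
  induction n, hjn using Nat.le_induction with
  | base => simp
  | succ n hjn ih =>
    rw [Finset.sum_Ico_succ_top hjn]
    have h1 := ih (Nat.le_of_succ_le hn)
    have h2 := step_bound hCm hβ hgf hsmall hgf4 hp hm hgfm (Nat.lt_of_succ_le hn)
    have e : (2 : ℝ) ^ (m + 2) / (p - 1) *
          (gbar β N gf (n + 1) ^ (p - 1) * (-Real.log (gbar β N gf (n + 1))) ^ m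
            - gbar β N gf j ^ (p - 1) * (-Real.log (gbar β N gf j)) ^ m)
        = (2 : ℝ) ^ (m + 2) / (p - 1) *
            (gbar β N gf n ^ (p - 1) * (-Real.log (gbar β N gf n)) ^ m
              - gbar β N gf j ^ (p - 1) * (-Real.log (gbar β N gf j)) ^ m)
          + (2 : ℝ) ^ (m + 2) / (p - 1) *
            (gbar β N gf (n + 1) ^ (p - 1) * (-Real.log (gbar β N gf (n + 1))) ^ m
              - gbar β N gf n ^ (p - 1) * (-Real.log (gbar β N gf n)) ^ m) := by ring
    rw [e]
    exact add_le_add h1 h2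

/-- **(basicbound), second line — PROVED with `𝒪(1) = 2^{m+2}/(p−1)`.**  For the backward quadratic
flow (`0 < C₋ ≤ β_k ≤ C₊`, `C₊g_f ≤ 1`), real `p > 1`, real `m ≥ 0`, and `g_f ≤ 1/4`,
`g_f ≤ exp(−2m/(p−1))`: for `j ≤ n ≤ N`,
`Σ_{ℓ∈[j,n)} β_ℓ ḡ_ℓ^p (−log ḡ_ℓ)^m ≤ (2^{m+2}/(p−1)) · ḡ_n^{p−1} (−log ḡ_n)^m`
(print: *"`Σ_{ℓ=j}^k β_ℓ ḡ_ℓ^n|log ḡ_ℓ|^m ≤ 𝒪(1) ḡ_{k+1}^{n−1}|log ḡ_{k+1}|^m`, `n > 1, m ≥ 0`"*, the case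
`n ↦ p`, `k + 1 ↦ n`).
[cite: DimockYuan2024GNFlow, remark after Lemma 17, (basicbound) second line (arXiv:2303.07916v3 TeX ll. 3386–3395; printed without proof, "similar to those of Lemma 2.1 in [BBS15c]")]
[cite: BauerschmidtBrydgesSlade2015Flow, Lemma 2.1 (ii-a), eq. (betagbd) (the infrared-directed twin, arXiv:1211.2477)] -/
theorem basicbound_two {Cm Cp p m : ℝ} (hCm : 0 < Cm) (hβ : ∀ k, Cm ≤ β k ∧ β k ≤ Cp)
    (hgf : 0 < gf) (hsmall : Cp * gf ≤ 1) (hgf4 : gf ≤ 1 / 4) (hp : 1 < p) (hm : 0 ≤ m)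
    (hgfm : gf ≤ Real.exp (-(2 * m / (p - 1)))) {j n : ℕ} (hjn : j ≤ n) (hn : n ≤ N) :
    ∑ ℓ ∈ Ico j n, β ℓ * gbar β N gf ℓ ^ p * (-Real.log (gbar β N gf ℓ)) ^ m ≤
      (2 : ℝ) ^ (m + 2) / (p - 1) *
        (gbar β N gf n ^ (p - 1) * (-Real.log (gbar β N gf n)) ^ m) := by
  have hβpos : ∀ k, 0 < β k := fun k => lt_of_lt_of_le hCm (hβ k).1
  have h := sum_le_potential_sub hCm hβ hgf hsmall hgf4 hp hm hgfm hjn hn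
  have hK : 0 ≤ (2 : ℝ) ^ (m + 2) / (p - 1) :=
    div_nonneg (Real.rpow_nonneg (by norm_num) _) (by linarith)
  have hx0 : 0 < gbar β N gf j := gbar_pos hβpos hgf (N := N) j
  have hx1 : gbar β N gf j < 1 := by
    linarith [(gbar_le_final hβpos hgf (N := N) j).trans hgf4]
  have hφj : 0 ≤ gbar β N gf j ^ (p - 1) * (-Real.log (gbar β N gf j)) ^ m := by
    have hL : 0 ≤ -Real.log (gbar β N gf j) := by
      have := Real.log_neg hx0 hx1; linarith
    exact mul_nonneg (Real.rpow_nonneg hx0.le _) (Real.rpow_nonneg hL _)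
  nlinarith [mul_nonneg hK hφj]

/-- For `0 < g < 1`: `|log g| = −log g`. [folklore] -/
theorem abs_log_eq_neg_log {g : ℝ} (hg0 : 0 < g) (hg1 : g < 1) :
    |Real.log g| = -Real.log g :=
  abs_of_neg (Real.log_neg hg0 hg1)

/-- `|log ḡ_k| = −log ḡ_k` along the flow when `g_f ≤ 1/4`. [folklore] -/
theorem abs_log_gbar {Cm Cp : ℝ} (hCm : 0 < Cm) (hβ : ∀ k, Cm ≤ β k ∧ β k ≤ Cp)
    (hgf : 0 < gf) (hgf4 : gf ≤ 1 / 4) (k : ℕ) :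
    |Real.log (gbar β N gf k)| = -Real.log (gbar β N gf k) := by
  have hβpos : ∀ k, 0 < β k := fun k => lt_of_lt_of_le hCm (hβ k).1
  exact abs_log_eq_neg_log (gbar_pos hβpos hgf (N := N) k)
    (by linarith [(gbar_le_final hβpos hgf (N := N) k).trans hgf4])

/-- **(basicbound), second line, in the printed `|log|`-form.**
[cite: DimockYuan2024GNFlow, remark after Lemma 17, (basicbound) second line (arXiv:2303.07916v3 TeX ll. 3386–3395; printed without proof)] -/
theorem basicbound_two_abs {Cm Cp p m : ℝ} (hCm : 0 < Cm) (hβ : ∀ k, Cm ≤ β k ∧ β k ≤ Cp)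
    (hgf : 0 < gf) (hsmall : Cp * gf ≤ 1) (hgf4 : gf ≤ 1 / 4) (hp : 1 < p) (hm : 0 ≤ m)
    (hgfm : gf ≤ Real.exp (-(2 * m / (p - 1)))) {j n : ℕ} (hjn : j ≤ n) (hn : n ≤ N) :
    ∑ ℓ ∈ Ico j n, β ℓ * gbar β N gf ℓ ^ p * |Real.log (gbar β N gf ℓ)| ^ m ≤
      (2 : ℝ) ^ (m + 2) / (p - 1) *
        (gbar β N gf n ^ (p - 1) * |Real.log (gbar β N gf n)| ^ m) := by
  have hab := fun k => abs_log_gbar (β := β) (N := N) hCm hβ hgf hgf4 k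
  simp_rw [hab]
  exact basicbound_two hCm hβ hgf hsmall hgf4 hp hm hgfm hjn hn

/-- **(basicbound2), first line**: `Σ_{ℓ∈[j,n)} ḡ_ℓ ≤ (2/C₋)|log ḡ_j|` (print: *"`Σ_{ℓ=j}^k ḡ_ℓ ≤ C|log ḡ_j|`"*
with *"`C = 𝒪(1)C₋⁻¹`"*), from the sibling's first line of (basicbound) (`𝒪(1) = 2`, needs `g_f ≤ 1`).
[cite: DimockYuan2024GNFlow, remark after Lemma 17, (basicbound2) first line (arXiv:2303.07916v3 TeX ll. 3396–3402)] -/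
theorem basicbound2_one {Cm Cp : ℝ} (hCm : 0 < Cm) (hβ : ∀ k, Cm ≤ β k ∧ β k ≤ Cp)
    (hgf : 0 < gf) (hgf1 : gf ≤ 1) (hsmall : Cp * gf ≤ 1) {j n : ℕ} (hjn : j ≤ n) (hn : n ≤ N) :
    ∑ ℓ ∈ Ico j n, gbar β N gf ℓ ≤ 2 / Cm * |Real.log (gbar β N gf j)| := by
  have hβpos : ∀ k, 0 < β k := fun k => lt_of_lt_of_le hCm (hβ k).1
  have h := sum_beta_gbar_le_abs_log (β := β) (N := N) hCm hβ hgf hgf1 hsmall hjn hn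
  have hterm : ∀ ℓ, gbar β N gf ℓ ≤ 1 / Cm * (β ℓ * gbar β N gf ℓ) := by
    intro ℓ
    have hx := (gbar_pos hβpos hgf (N := N) ℓ).le
    rw [one_div, ← mul_assoc, inv_mul_eq_div, div_mul_eq_mul_div, le_div_iff₀ hCm]
    calc gbar β N gf ℓ * Cm = Cm * gbar β N gf ℓ := by ring
      _ ≤ β ℓ * gbar β N gf ℓ := mul_le_mul_of_nonneg_right (hβ ℓ).1 hx
  calc ∑ ℓ ∈ Ico j n, gbar β N gf ℓ
      ≤ ∑ ℓ ∈ Ico j n, 1 / Cm * (β ℓ * gbar β N gf ℓ) := Finset.sum_le_sum fun ℓ _ => hterm ℓ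
    _ = 1 / Cm * ∑ ℓ ∈ Ico j n, β ℓ * gbar β N gf ℓ := by rw [Finset.mul_sum]
    _ ≤ 1 / Cm * (2 * |Real.log (gbar β N gf j)|) :=
        mul_le_mul_of_nonneg_left h (by positivity)
    _ = 2 / Cm * |Real.log (gbar β N gf j)| := by ring

/-- **(basicbound2), second line**: `Σ_{ℓ∈[j,n)} ḡ_ℓ^p|log ḡ_ℓ|^m ≤ (2^{m+2}/((p−1)C₋))·ḡ_n^{p−1}|log ḡ_n|^m`
(print: *"`Σ_{ℓ=j}^k ḡ_ℓ^n|log ḡ_ℓ|^m ≤ C ḡ_{k+1}^{n−1}|log ḡ_{k+1}|^m`, `n > 1, m ≥ 0`"*, *"`C = 𝒪(1)C₋⁻¹`"*).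
[cite: DimockYuan2024GNFlow, remark after Lemma 17, (basicbound2) second line (arXiv:2303.07916v3 TeX ll. 3396–3402)] -/
theorem basicbound2_two {Cm Cp p m : ℝ} (hCm : 0 < Cm) (hβ : ∀ k, Cm ≤ β k ∧ β k ≤ Cp)
    (hgf : 0 < gf) (hsmall : Cp * gf ≤ 1) (hgf4 : gf ≤ 1 / 4) (hp : 1 < p) (hm : 0 ≤ m)
    (hgfm : gf ≤ Real.exp (-(2 * m / (p - 1)))) {j n : ℕ} (hjn : j ≤ n) (hn : n ≤ N) :
    ∑ ℓ ∈ Ico j n, gbar β N gf ℓ ^ p * |Real.log (gbar β N gf ℓ)| ^ m ≤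
      (2 : ℝ) ^ (m + 2) / ((p - 1) * Cm) *
        (gbar β N gf n ^ (p - 1) * |Real.log (gbar β N gf n)| ^ m) := by
  have hβpos : ∀ k, 0 < β k := fun k => lt_of_lt_of_le hCm (hβ k).1
  have h := basicbound_two_abs hCm hβ hgf hsmall hgf4 hp hm hgfm hjn hn
  have hterm : ∀ ℓ, gbar β N gf ℓ ^ p * |Real.log (gbar β N gf ℓ)| ^ m ≤
      1 / Cm * (β ℓ * gbar β N gf ℓ ^ p * |Real.log (gbar β N gf ℓ)| ^ m) := by
    intro ℓ
    have hx : 0 ≤ gbar β N gf ℓ ^ p * |Real.log (gbar β N gf ℓ)| ^ m :=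
      mul_nonneg (Real.rpow_nonneg (gbar_pos hβpos hgf (N := N) ℓ).le _)
        (Real.rpow_nonneg (abs_nonneg _) _)
    have h1 : (1 : ℝ) ≤ 1 / Cm * β ℓ := by
      rw [one_div, inv_mul_eq_div, le_div_iff₀ hCm, one_mul]; exact (hβ ℓ).1
    calc gbar β N gf ℓ ^ p * |Real.log (gbar β N gf ℓ)| ^ m
        = 1 * (gbar β N gf ℓ ^ p * |Real.log (gbar β N gf ℓ)| ^ m) := (one_mul _).symm
      _ ≤ (1 / Cm * β ℓ) * (gbar β N gf ℓ ^ p * |Real.log (gbar β N gf ℓ)| ^ m) :=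
          mul_le_mul_of_nonneg_right h1 hx
      _ = 1 / Cm * (β ℓ * gbar β N gf ℓ ^ p * |Real.log (gbar β N gf ℓ)| ^ m) := by ring
  have hp0 : 0 < p - 1 := by linarith
  calc ∑ ℓ ∈ Ico j n, gbar β N gf ℓ ^ p * |Real.log (gbar β N gf ℓ)| ^ m
      ≤ ∑ ℓ ∈ Ico j n, 1 / Cm * (β ℓ * gbar β N gf ℓ ^ p * |Real.log (gbar β N gf ℓ)| ^ m) :=
        Finset.sum_le_sum fun ℓ _ => hterm ℓ
    _ = 1 / Cm * ∑ ℓ ∈ Ico j n, β ℓ * gbar β N gf ℓ ^ p * |Real.log (gbar β N gf ℓ)| ^ m := by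
        rw [Finset.mul_sum]
    _ ≤ 1 / Cm * ((2 : ℝ) ^ (m + 2) / (p - 1) *
          (gbar β N gf n ^ (p - 1) * |Real.log (gbar β N gf n)| ^ m)) :=
        mul_le_mul_of_nonneg_left h (by positivity)
    _ = (2 : ℝ) ^ (m + 2) / ((p - 1) * Cm) *
          (gbar β N gf n ^ (p - 1) * |Real.log (gbar β N gf n)| ^ m) := by
        field_simp

/-! ## Part 3. Lemma 19 (γ-products along the flow) -/

-- The elementary inequality `u − u² ≤ log(1 + u)` (`u ≥ 0`; from `1 − (1+u)⁻¹ ≤ log(1+u)` and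
-- `u − u² ≤ u/(1+u)`) is already in the tree as
-- `Literature.Analysis.SpecialFunctions.GammaRatio.sub_sq_le_log_one_add` (module
-- `Literature/Analysis/SpecialFunctions/GammaVerticalRatio.lean`); it is REUSED BY NAME (gate dedup).
open Literature.Analysis.SpecialFunctions.GammaRatio (sub_sq_le_log_one_add)

/-- Per-factor upper bound: `1 + γt ≤ (1 + t)^γ · e^{γ t²}` for `γ, t ≥ 0`
(`log(1+γt) ≤ γt ≤ γ(log(1+t) + t²)`). [folklore] (the print's "`α_i = 𝒪(ḡ_i²)`",
[cite: DimockYuan2024GNFlow, proof of Lemma 19 (arXiv:2303.07916v3 TeX ll. 3714–3722)]) -/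
theorem one_add_mul_le_rpow_mul_exp {γ t : ℝ} (hγ : 0 ≤ γ) (ht : 0 ≤ t) :
    1 + γ * t ≤ (1 + t) ^ γ * Real.exp (γ * t ^ 2) := by
  have hpos : 0 < 1 + γ * t := by nlinarith [mul_nonneg hγ ht]
  have h1t : 0 < 1 + t := by linarith
  have hlog1 : Real.log (1 + γ * t) ≤ γ * t := by
    have := Real.log_le_sub_one_of_pos hpos; linarith
  have hlog2 : γ * t ≤ γ * (Real.log (1 + t) + t ^ 2) := by
    have := sub_sq_le_log_one_add ht
    exact mul_le_mul_of_nonneg_left (by linarith) hγ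
  calc 1 + γ * t = Real.exp (Real.log (1 + γ * t)) := (Real.exp_log hpos).symm
    _ ≤ Real.exp (Real.log (1 + t) * γ + γ * t ^ 2) := by
        apply Real.exp_le_exp.mpr; linarith
    _ = (1 + t) ^ γ * Real.exp (γ * t ^ 2) := by
        rw [Real.exp_add, Real.rpow_def_of_pos h1t]

/-- Per-factor lower bound: `(1 + t)^γ · e^{−γ²t²} ≤ 1 + γt` for `γ, t ≥ 0`
(`γ log(1+t) − γ²t² ≤ γt − (γt)² ≤ log(1+γt)`). [folklore]
([cite: DimockYuan2024GNFlow, proof of Lemma 19 (arXiv:2303.07916v3 TeX ll. 3714–3722)]) -/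
theorem rpow_mul_exp_neg_le_one_add_mul {γ t : ℝ} (hγ : 0 ≤ γ) (ht : 0 ≤ t) :
    (1 + t) ^ γ * Real.exp (-(γ ^ 2 * t ^ 2)) ≤ 1 + γ * t := by
  have hpos : 0 < 1 + γ * t := by nlinarith [mul_nonneg hγ ht]
  have h1t : 0 < 1 + t := by linarith
  have hlog1 : γ * Real.log (1 + t) ≤ γ * t := by
    have := Real.log_le_sub_one_of_pos h1t
    exact mul_le_mul_of_nonneg_left (by linarith) hγ
  have hlog2 : γ * t - (γ * t) ^ 2 ≤ Real.log (1 + γ * t) :=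
    sub_sq_le_log_one_add (mul_nonneg hγ ht)
  calc (1 + t) ^ γ * Real.exp (-(γ ^ 2 * t ^ 2))
      = Real.exp (Real.log (1 + t) * γ + -(γ ^ 2 * t ^ 2)) := by
        rw [Real.exp_add, Real.rpow_def_of_pos h1t]
    _ ≤ Real.exp (Real.log (1 + γ * t)) := by
        apply Real.exp_le_exp.mpr
        have : (γ * t) ^ 2 = γ ^ 2 * t ^ 2 := by ring
        nlinarith [hlog1, hlog2, this]
    _ = 1 + γ * t := Real.exp_log hpos

/-- The telescoping product: *"from `(1 + β_iḡ_i) = ḡ_{i+1}/ḡ_i`: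
`Π_{i=ℓ}^{k−1}(1 + β_iḡ_i)^γ = (ḡ_k/ḡ_ℓ)^γ`"* — here `Π_{i∈[ℓ,k)}(1 + β_iḡ_i) = ḡ_k/ḡ_ℓ` for `ℓ ≤ k ≤ N`.
[cite: DimockYuan2024GNFlow, proof of Lemma 19 (arXiv:2303.07916v3 TeX ll. 3722–3725)] -/
theorem prod_one_add_beta_gbar (hβ : ∀ k, 0 < β k) (hgf : 0 < gf) {ℓ k : ℕ} (hℓk : ℓ ≤ k)
    (hk : k ≤ N) :
    ∏ i ∈ Ico ℓ k, (1 + β i * gbar β N gf i) = gbar β N gf k / gbar β N gf ℓ := by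
  induction k, hℓk using Nat.le_induction with
  | base => rw [Finset.Ico_self, Finset.prod_empty, div_self (gbar_pos hβ hgf (N := N) ℓ).ne']
  | succ k hℓk ih =>
    rw [Finset.prod_Ico_succ_top hℓk, ih (Nat.le_of_succ_le hk),
      gbar_succ hβ hgf (Nat.lt_of_succ_le hk)]
    have hx := (gbar_pos hβ hgf (N := N) k).ne'
    have hl := (gbar_pos hβ hgf (N := N) ℓ).ne'
    field_simp

/-- **Lemma 19 with the correction factors written out**: for `γ ≥ 0`, `0 < C₋ ≤ β ≤ C₊` and
`ℓ ≤ k ≤ N` (no smallness needed at this stage),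
`(ḡ_k/ḡ_ℓ)^γ · e^{−γ²C₊(ḡ_k − ḡ_ℓ)} ≤ Π_{i∈[ℓ,k)}(1 + γβ_iḡ_i) ≤ (ḡ_k/ḡ_ℓ)^γ · e^{γC₊(ḡ_k − ḡ_ℓ)}`
(the print's `Π(1 + α_i)` with `|log Π(1+α_i)| ≤ max(γ,γ²)·Σ(β_iḡ_i)² ≤ max(γ,γ²)·C₊·Σβ_iḡ_i² =
max(γ,γ²)C₊(ḡ_k − ḡ_ℓ)` by the sibling's telescoping `sum_beta_gbar_sq`).
[cite: DimockYuan2024GNFlow, Lemma 19 and its proof (arXiv:2303.07916v3 TeX ll. 3705–3725)] -/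
theorem prod_bounds_exp {Cm Cp γ : ℝ} (hCm : 0 < Cm) (hβ : ∀ k, Cm ≤ β k ∧ β k ≤ Cp)
    (hgf : 0 < gf) (hγ : 0 ≤ γ) {ℓ k : ℕ} (hℓk : ℓ ≤ k) (hk : k ≤ N) :
    (gbar β N gf k / gbar β N gf ℓ) ^ γ * Real.exp (-(γ ^ 2 * Cp * (gbar β N gf k - gbar β N gf ℓ)))
        ≤ ∏ i ∈ Ico ℓ k, (1 + γ * β i * gbar β N gf i) ∧
      ∏ i ∈ Ico ℓ k, (1 + γ * β i * gbar β N gf i) ≤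
        (gbar β N gf k / gbar β N gf ℓ) ^ γ * Real.exp (γ * Cp * (gbar β N gf k - gbar β N gf ℓ)) := by
  have hβpos : ∀ k, 0 < β k := fun k => lt_of_lt_of_le hCm (hβ k).1
  have hCp : 0 ≤ Cp := le_trans hCm.le ((hβ 0).1.trans (hβ 0).2)
  have hgl := gbar_pos hβpos hgf (N := N) ℓ
  induction k, hℓk using Nat.le_induction with
  | base =>
    simp only [Finset.Ico_self, Finset.prod_empty, sub_self, mul_zero, neg_zero, Real.exp_zero,
      mul_one, div_self hgl.ne', Real.one_rpow]
    exact ⟨le_rfl, le_rfl⟩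
  | succ k hℓk ih =>
    obtain ⟨ih1, ih2⟩ := ih (Nat.le_of_succ_le hk)
    have hkN : k < N := Nat.lt_of_succ_le hk
    set x := gbar β N gf k with hxdef
    set y := gbar β N gf (k + 1) with hydef
    set gl := gbar β N gf ℓ with hgldef
    have hx0 : 0 < x := gbar_pos hβpos hgf (N := N) k
    have hy0 : 0 < y := gbar_pos hβpos hgf (N := N) (k + 1)
    have hsucc : y = x + β k * x ^ 2 := gbar_succ hβpos hgf hkN
    set t := β k * x with htdef
    have ht0 : 0 ≤ t := (mul_pos (hβpos k) hx0).le
    have hyx : y = x * (1 + t) := by rw [hsucc, htdef]; ring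
    -- t² ≤ C₊ (y - x)
    have ht2 : t ^ 2 ≤ Cp * (y - x) := by
      have e : y - x = β k * x ^ 2 := by rw [hsucc]; ring
      rw [e, htdef]
      have : (β k * x) ^ 2 = β k * (β k * x ^ 2) := by ring
      rw [this]
      exact mul_le_mul_of_nonneg_right (hβ k).2
        (mul_nonneg (hβpos k).le (sq_nonneg x))
    -- ratio bookkeeping: (x/gl)^γ (1+t)^γ = (y/gl)^γ
    have hratio : (x / gl) ^ γ * (1 + t) ^ γ = (y / gl) ^ γ := by
      rw [← Real.mul_rpow (div_pos hx0 hgl).le (by linarith), hyx]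
      congr 1
      field_simp
    have hU := one_add_mul_le_rpow_mul_exp hγ ht0      -- 1 + γt ≤ (1+t)^γ e^{γt²}
    have hL := rpow_mul_exp_neg_le_one_add_mul hγ ht0  -- (1+t)^γ e^{-γ²t²} ≤ 1 + γt
    have hfac : 1 + γ * β k * x = 1 + γ * t := by rw [htdef]; ring
    rw [Finset.prod_Ico_succ_top hℓk, hfac]
    have hP0 : 0 ≤ ∏ i ∈ Ico ℓ k, (1 + γ * β i * gbar β N gf i) :=
      Finset.prod_nonneg fun i _ => by
        have := mul_nonneg (mul_nonneg hγ (hβpos i).le) (gbar_pos hβpos hgf (N := N) i).le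
        linarith
    have hxg : 0 ≤ (x / gl) ^ γ := Real.rpow_nonneg (div_pos hx0 hgl).le _
    constructor
    · -- lower bound
      have hA : 0 ≤ (x / gl) ^ γ * Real.exp (-(γ ^ 2 * Cp * (x - gl))) :=
        mul_nonneg hxg (Real.exp_pos _).le
      have hB : 0 ≤ (1 + t) ^ γ * Real.exp (-(γ ^ 2 * t ^ 2)) :=
        mul_nonneg (Real.rpow_nonneg (by linarith) _) (Real.exp_pos _).le
      have h := mul_le_mul ih1 hL hB hP0
      refine le_trans ?_ h
      -- (y/gl)^γ e^{-γ²C₊(y-gl)} ≤ (x/gl)^γ e^{-γ²C₊(x-gl)} (1+t)^γ e^{-γ²t²}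
      have e : (x / gl) ^ γ * Real.exp (-(γ ^ 2 * Cp * (x - gl))) *
            ((1 + t) ^ γ * Real.exp (-(γ ^ 2 * t ^ 2)))
          = (y / gl) ^ γ * Real.exp (-(γ ^ 2 * Cp * (x - gl)) + -(γ ^ 2 * t ^ 2)) := by
        rw [Real.exp_add, ← hratio]; ring
      rw [e]
      apply mul_le_mul_of_nonneg_left _ (Real.rpow_nonneg (div_pos hy0 hgl).le _)
      apply Real.exp_le_exp.mpr
      have hγ2 : 0 ≤ γ ^ 2 := sq_nonneg γ
      nlinarith [mul_le_mul_of_nonneg_left ht2 hγ2]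
    · -- upper bound
      have hB : 0 ≤ (1 + t) ^ γ * Real.exp (γ * t ^ 2) :=
        mul_nonneg (Real.rpow_nonneg (by linarith) _) (Real.exp_pos _).le
      have h1t : 0 ≤ 1 + γ * t := by nlinarith [mul_nonneg hγ ht0]
      have hbnd : 0 ≤ (x / gl) ^ γ * Real.exp (γ * Cp * (x - gl)) :=
        mul_nonneg hxg (Real.exp_pos _).le
      have h := mul_le_mul ih2 hU h1t hbnd
      refine le_trans h ?_
      have e : (x / gl) ^ γ * Real.exp (γ * Cp * (x - gl)) * ((1 + t) ^ γ * Real.exp (γ * t ^ 2))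
          = (y / gl) ^ γ * Real.exp (γ * Cp * (x - gl) + γ * t ^ 2) := by
        rw [Real.exp_add, ← hratio]; ring
      rw [e]
      apply mul_le_mul_of_nonneg_left _ (Real.rpow_nonneg (div_pos hy0 hgl).le _)
      apply Real.exp_le_exp.mpr
      nlinarith [mul_le_mul_of_nonneg_left ht2 hγ]

/-- **Dimock–Yuan 2024, Lemma 19 — PROVED**, the smallness made explicit (and γ-dependent): for
`γ ≥ 0`, `0 < C₋ ≤ β ≤ C₊`, `γ·C₊g_f ≤ log(3/2)` and `γ²·C₊g_f ≤ log 2`, and `ℓ ≤ k ≤ N`: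
`½(ḡ_k/ḡ_ℓ)^γ ≤ Π_{i∈[ℓ,k)}(1 + γβ_iḡ_i) ≤ (3/2)(ḡ_k/ḡ_ℓ)^γ`
(print: *"For `g_f` sufficiently small and `γ > 0` `½(ḡ_k/ḡ_ℓ)^γ ≤ Π_{i=ℓ}^{k−1}(1 + γβ_iḡ_i) ≤ (3/2)(ḡ_k/ḡ_ℓ)^γ`"*).
[cite: DimockYuan2024GNFlow, Lemma 19 (arXiv:2303.07916v3 TeX ll. 3705–3711; six-line proof sketch ll. 3714–3725)] -/
theorem DimockYuan2024_lemma19 {Cm Cp γ : ℝ} (hCm : 0 < Cm) (hβ : ∀ k, Cm ≤ β k ∧ β k ≤ Cp)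
    (hgf : 0 < gf) (hγ : 0 ≤ γ)
    (hγ1 : γ * (Cp * gf) ≤ Real.log (3 / 2)) (hγ2 : γ ^ 2 * (Cp * gf) ≤ Real.log 2)
    {ℓ k : ℕ} (hℓk : ℓ ≤ k) (hk : k ≤ N) :
    1 / 2 * (gbar β N gf k / gbar β N gf ℓ) ^ γ ≤ ∏ i ∈ Ico ℓ k, (1 + γ * β i * gbar β N gf i) ∧
      ∏ i ∈ Ico ℓ k, (1 + γ * β i * gbar β N gf i) ≤
        3 / 2 * (gbar β N gf k / gbar β N gf ℓ) ^ γ := by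
  have hβpos : ∀ k, 0 < β k := fun k => lt_of_lt_of_le hCm (hβ k).1
  have hCp : 0 ≤ Cp := le_trans hCm.le ((hβ 0).1.trans (hβ 0).2)
  obtain ⟨h1, h2⟩ := prod_bounds_exp (β := β) (N := N) hCm hβ hgf hγ hℓk hk
  have hgl := gbar_pos hβpos hgf (N := N) ℓ
  have hgk := gbar_pos hβpos hgf (N := N) k
  have hdiff : gbar β N gf k - gbar β N gf ℓ ≤ gf := by
    linarith [gbar_le_final hβpos hgf (N := N) k, hgl.le]
  have hR : 0 ≤ (gbar β N gf k / gbar β N gf ℓ) ^ γ := Real.rpow_nonneg (div_pos hgk hgl).le _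
  constructor
  · refine le_trans ?_ h1
    rw [mul_comm]
    apply mul_le_mul_of_nonneg_left _ hR
    -- 1/2 ≤ exp(-γ²C₊(ḡ_k-ḡ_ℓ))
    have hle : γ ^ 2 * Cp * (gbar β N gf k - gbar β N gf ℓ) ≤ Real.log 2 := by
      have := mul_le_mul_of_nonneg_left hdiff (mul_nonneg (sq_nonneg γ) hCp)
      linarith
    calc (1 / 2 : ℝ) = Real.exp (-Real.log 2) := by
          rw [Real.exp_neg, Real.exp_log (by norm_num)]; norm_num
      _ ≤ Real.exp (-(γ ^ 2 * Cp * (gbar β N gf k - gbar β N gf ℓ))) :=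
          Real.exp_le_exp.mpr (by linarith)
  · refine le_trans h2 ?_
    rw [mul_comm (3 / 2 : ℝ)]
    apply mul_le_mul_of_nonneg_left _ hR
    have hle : γ * Cp * (gbar β N gf k - gbar β N gf ℓ) ≤ Real.log (3 / 2) := by
      have := mul_le_mul_of_nonneg_left hdiff (mul_nonneg hγ hCp)
      linarith
    calc Real.exp (γ * Cp * (gbar β N gf k - gbar β N gf ℓ))
        ≤ Real.exp (Real.log (3 / 2)) := Real.exp_le_exp.mpr hle
      _ = 3 / 2 := Real.exp_log (by norm_num)

/-- The inverted form used for the factors `A_k = (1 + 2β_kḡ_k)⁻¹` (print, l. 3656: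
*"`Π_{i=ℓ}^{j} A_{N−i} ≤ 𝒪(1)(ḡ_{N−j}/ḡ_{N−ℓ+1})²`"*): under the hypotheses of Lemma 19,
`Π_{i∈[ℓ,k)}(1 + γβ_iḡ_i)⁻¹ ≤ 2·(ḡ_ℓ/ḡ_k)^γ`.
[cite: DimockYuan2024GNFlow, Lemma 19 and proof of Lemma 18 (arXiv:2303.07916v3 TeX ll. 3654–3656, 3705–3711)] -/
theorem prod_inv_le {Cm Cp γ : ℝ} (hCm : 0 < Cm) (hβ : ∀ k, Cm ≤ β k ∧ β k ≤ Cp)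
    (hgf : 0 < gf) (hγ : 0 ≤ γ)
    (hγ1 : γ * (Cp * gf) ≤ Real.log (3 / 2)) (hγ2 : γ ^ 2 * (Cp * gf) ≤ Real.log 2)
    {ℓ k : ℕ} (hℓk : ℓ ≤ k) (hk : k ≤ N) :
    ∏ i ∈ Ico ℓ k, (1 + γ * β i * gbar β N gf i)⁻¹ ≤
      2 * (gbar β N gf ℓ / gbar β N gf k) ^ γ := by
  have hβpos : ∀ k, 0 < β k := fun k => lt_of_lt_of_le hCm (hβ k).1
  obtain ⟨h1, -⟩ := DimockYuan2024_lemma19 (β := β) (N := N) hCm hβ hgf hγ hγ1 hγ2 hℓk hk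
  have hgl := gbar_pos hβpos hgf (N := N) ℓ
  have hgk := gbar_pos hβpos hgf (N := N) k
  have hRpos : 0 < (gbar β N gf k / gbar β N gf ℓ) ^ γ := Real.rpow_pos_of_pos (div_pos hgk hgl) _
  rw [Finset.prod_inv_distrib]
  have hP : 0 < ∏ i ∈ Ico ℓ k, (1 + γ * β i * gbar β N gf i) :=
    lt_of_lt_of_le (by positivity) h1
  rw [inv_le_comm₀ hP (by positivity)]
  have e : (2 * (gbar β N gf ℓ / gbar β N gf k) ^ γ)⁻¹
      = 1 / 2 * (gbar β N gf k / gbar β N gf ℓ) ^ γ := by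
    rw [mul_inv, ← Real.inv_rpow (div_pos hgl hgk).le, inv_div]
    ring
  rw [e]
  exact h1

/-! ## Part 4. The two instances used in the proof of Lemma 18 -/

/-- `1/4 ≤ e^{−1}` (since `e < 3 < 4`). [folklore] -/
theorem quarter_le_exp_neg_one : (1 / 4 : ℝ) ≤ Real.exp (-1) := by
  have h := Real.exp_one_lt_three
  have hpos := Real.exp_pos (1 : ℝ)
  rw [Real.exp_neg, inv_eq_one_div, div_le_div_iff₀ (by norm_num) hpos]
  linarith

/-- (amos3): with `γ = √2`, `ḡ_k^γ·Σ_{ℓ<k} ḡ_ℓ^{3−γ} ≤ C·ḡ_k²` — here `C = 4/((2 − √2)C₋)`, from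
(basicbound2) with the REAL exponent `p = 3 − √2 ∈ (1,2)`, `m = 0`; needs only `g_f ≤ 1/4`, `C₊g_f ≤ 1`.
[cite: DimockYuan2024GNFlow, proof of Lemma 18, eq. (amos3) (arXiv:2303.07916v3 TeX ll. 3628–3631)] -/
theorem amos3_sum {Cm Cp : ℝ} (hCm : 0 < Cm) (hβ : ∀ k, Cm ≤ β k ∧ β k ≤ Cp)
    (hgf : 0 < gf) (hsmall : Cp * gf ≤ 1) (hgf4 : gf ≤ 1 / 4) {k : ℕ} (hk : k ≤ N) :
    gbar β N gf k ^ Real.sqrt 2 * ∑ ℓ ∈ Ico 0 k, gbar β N gf ℓ ^ (3 - Real.sqrt 2) ≤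
      4 / ((2 - Real.sqrt 2) * Cm) * gbar β N gf k ^ 2 := by
  have hβpos : ∀ k, 0 < β k := fun k => lt_of_lt_of_le hCm (hβ k).1
  have hs2 : Real.sqrt 2 < 2 := by
    rw [show (2 : ℝ) = Real.sqrt 4 by
      rw [show (4 : ℝ) = 2 ^ 2 by norm_num, Real.sqrt_sq (by norm_num)]]
    exact Real.sqrt_lt_sqrt (by norm_num) (by norm_num)
  have hp : 1 < 3 - Real.sqrt 2 := by linarith
  have hgfm : gf ≤ Real.exp (-(2 * (0 : ℝ) / (3 - Real.sqrt 2 - 1))) := by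
    simp only [mul_zero, zero_div, neg_zero, Real.exp_zero]
    linarith
  have h := basicbound2_two (β := β) (N := N) (p := 3 - Real.sqrt 2) (m := 0) hCm hβ hgf hsmall
    hgf4 hp le_rfl hgfm (Nat.zero_le k) hk
  simp only [Real.rpow_zero, mul_one, zero_add] at h
  have hgk := gbar_pos hβpos hgf (N := N) k
  have hR : 0 ≤ gbar β N gf k ^ Real.sqrt 2 := Real.rpow_nonneg hgk.le _
  have h2 := mul_le_mul_of_nonneg_left h hR
  refine le_trans h2 (le_of_eq ?_)
  have e1 : (3 - Real.sqrt 2 - 1) = 2 - Real.sqrt 2 := by ring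
  have e2 : gbar β N gf k ^ Real.sqrt 2 * gbar β N gf k ^ (3 - Real.sqrt 2 - 1)
      = gbar β N gf k ^ 2 := by
    rw [← Real.rpow_add hgk, ← Real.rpow_two]
    congr 1; ring
  rw [Real.rpow_two, e1]
  calc gbar β N gf k ^ Real.sqrt 2 * ((2 : ℝ) ^ 2 / ((2 - Real.sqrt 2) * Cm) *
        gbar β N gf k ^ (2 - Real.sqrt 2))
      = (2 : ℝ) ^ 2 / ((2 - Real.sqrt 2) * Cm) *
        (gbar β N gf k ^ Real.sqrt 2 * gbar β N gf k ^ (3 - Real.sqrt 2 - 1)) := by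
        rw [e1]; ring
    _ = 4 / ((2 - Real.sqrt 2) * Cm) * gbar β N gf k ^ 2 := by rw [e2]; norm_num

/-- The `z_k`-equation instance: `Σ_{ℓ<k} ḡ_ℓ³|log ḡ_ℓ| ≤ C·ḡ_k²|log ḡ_k|` — here `C = 4/C₋`, from
(basicbound2) with `p = 3`, `m = 1` (smallness `g_f ≤ e^{−1}` implied by `g_f ≤ 1/4`).
[cite: DimockYuan2024GNFlow, proof of Lemma 18 (arXiv:2303.07916v3 TeX ll. 3692–3696)] -/
theorem zsum_bound {Cm Cp : ℝ} (hCm : 0 < Cm) (hβ : ∀ k, Cm ≤ β k ∧ β k ≤ Cp)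
    (hgf : 0 < gf) (hsmall : Cp * gf ≤ 1) (hgf4 : gf ≤ 1 / 4) {k : ℕ} (hk : k ≤ N) :
    ∑ ℓ ∈ Ico 0 k, gbar β N gf ℓ ^ (3 : ℝ) * |Real.log (gbar β N gf ℓ)| ≤
      4 / Cm * (gbar β N gf k ^ (2 : ℝ) * |Real.log (gbar β N gf k)|) := by
  have hp : (1 : ℝ) < 3 := by norm_num
  have hgfm : gf ≤ Real.exp (-(2 * (1 : ℝ) / (3 - 1))) := by
    norm_num
    exact hgf4.trans quarter_le_exp_neg_one
  have h := basicbound2_two (β := β) (N := N) (p := 3) (m := 1) hCm hβ hgf hsmall hgf4 hp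
    zero_le_one hgfm (Nat.zero_le k) hk
  simp only [Real.rpow_one] at h
  have e1 : (2 : ℝ) ^ ((1 : ℝ) + 2) = 8 := by
    rw [show ((1 : ℝ) + 2) = ((3 : ℕ) : ℝ) by norm_num, Real.rpow_natCast]; norm_num
  have e2 : ((3 : ℝ) - 1) = 2 := by norm_num
  rw [e1, e2] at h
  have e3 : (8 : ℝ) / (2 * Cm) = 4 / Cm := by
    field_simp; ring
  rw [e3] at h
  exact h

end Literature.MathematicalPhysics.QuantumFieldTheory.DimockYuan2024.QuadraticFlowSums

end
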